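import Summits.HodgeConjecture.HodgeConjecture.Theorems.PadicSemiregularLiftFermatAnchorAssemblyStubTransferLeaf

/-!
# Crux `FermatAnchorAssembly` (stmt-HodgeConjecture-14874), line `Sketch`: the ZERO-SEED FALLBACK (HC-sandwich over the leaf facts)

Route `PadicSemiregularLift` of `HodgeConjecture`; crux
`FermatAnchorAssembly := PadicPridhamSemiregularity → FormalLiftingFromClassLifting → FormalVectorBundlesAlgebraize →
HodgeFermatVarieties`. The line's transfer is landed modulo the three LEAF print facts
(`stub_transfer_of_leaf_facts`, `Theorems/PadicSemiregularLiftFermatAnchorAssemblyStubTransferLeaf.lean`): HC for all powers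
`J(C_m)ᴺ⁺¹` of the Fermat Jacobians gives `HodgeFermatVarieties`. Its hypothesis `HodgeFermatJacobianPowersAt m C 𝒥` is an
instance of the route's abelian crux `HodgeAbelianVarieties` (the hosts are complex abelian varieties), so — as the line card
`Ideas/parallelizable-avatar.md` records under "ZERO-SEED FALLBACK (the corollary reading, for the lead)" — the crux also closes
WITHOUT any Fermat-specific seed:

* from `HodgeAbelianVarieties` (route item stmt-HodgeConjecture-1333) and the leaf facts — the engine hypotheses unused
  (`fermatAnchorAssembly_of_hodgeAbelianVarieties_of_leaf_facts`); in particular the route's Fermat target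
  `HodgeFermatVarieties` (stmt-HodgeConjecture-1334) follows from its abelian target modulo the leaf facts
  (`hodgeFermatVarieties_of_hodgeAbelianVarieties_of_leaf_facts`, the coarse Shioda–Katsura + Abel–Jacobi transfer);
* from the sibling glue node `AbelianAnchorAssembly` (stmt-HodgeConjecture-14913) and `HodgeLocusPropagation`
  (stmt-HodgeConjecture-14977) with the engine hypotheses h1a, h3a CONSUMED (passed to the abelian node) and h1b idle
  (`fermatAnchorAssembly_of_abelianAnchorAssembly_of_leaf_facts`, registered sub-goal).

So, in the route's dependency graph, this crux is dominated by {three leaf print facts, stmt-14913, stmt-14977}; its only content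
beyond the abelian node is the transfer. Sources: Shioda–Katsura 1979 Thm 1.7 (domination of `Xⁿₘ` by `Cₘⁿ`), Milne 1986 (Jacobians).
-/

-- `Summit.HodgeConjecture.HodgeConjecture.…` is the tree's mandated summit/problem namespace (single-problem summit).
set_option linter.dupNamespace false

noncomputable section

open CategoryTheory AlgebraicGeometry
open Literature.AlgebraicGeometry Literature.AlgebraicGeometry.Motives
  Literature.AlgebraicGeometry.HodgeTheory
open Summit.HodgeConjecture.HodgeConjecture.Theses.PadicSemiregularLift

namespace Summit.HodgeConjecture.HodgeConjecture.Cruxes.FermatAnchorAssembly.ParallelizableAvatar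

/-- HC for all complex abelian varieties gives HC for every power `J(C)ᴺ⁺¹` of a Jacobian of a Fermat curve (the hosts
of the line are abelian varieties; the Fermat hypotheses are not used). [folklore] -/
theorem hodgeFermatJacobianPowersAt_of_hodgeAbelianVarieties (hA : HodgeAbelianVarieties) (m : ℕ) (C : SchemeOver ℂ)
    (𝒥 : Jacobian C) : HodgeFermatJacobianPowersAt m C 𝒥 :=
  fun _ _ N => hA (𝒥.J.powSucc N)

/-- **The coarse transfer** (Shioda–Katsura domination + Abel–Jacobi, modulo the three leaf print facts): HC for complex
abelian varieties (route item `HodgeAbelianVarieties`, stmt-HodgeConjecture-1333) implies HC for every complex Fermat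
hypersurface (route item `HodgeFermatVarieties`, stmt-HodgeConjecture-1334). [cite: ShiodaKatsura1979, §1 Thm. 1.7]
[cite: Milne1986JacobianVarieties, Thm. 1.1 and §2 Prop. 2.1] -/
theorem hodgeFermatVarieties_of_hodgeAbelianVarieties_of_leaf_facts
    (hSK : Literature.AlgebraicGeometry.HodgeTheory.FermatHodgeClassesLiftToCurvePowersSum)
    (hdim : two_mul_dim_eq_finrank_bettiCohomology) (hJ : nonempty_jacobian_of_algPoints.{0})
    (hA : HodgeAbelianVarieties) : HodgeFermatVarieties :=
  stub_transfer_of_leaf_facts hSK hdim hJ (hodgeFermatJacobianPowersAt_of_hodgeAbelianVarieties hA)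

/-- **Zero-seed fallback, form 1**: the crux from `HodgeAbelianVarieties` and the leaf facts; the engine hypotheses
h1b, h1a, h3a are not used (HC-sandwich). [cite: ShiodaKatsura1979, §1 Thm. 1.7] -/
theorem fermatAnchorAssembly_of_hodgeAbelianVarieties_of_leaf_facts
    (hSK : Literature.AlgebraicGeometry.HodgeTheory.FermatHodgeClassesLiftToCurvePowersSum)
    (hdim : two_mul_dim_eq_finrank_bettiCohomology) (hJ : nonempty_jacobian_of_algPoints.{0})
    (hA : HodgeAbelianVarieties) : FermatAnchorAssembly :=
  fun _ _ _ => hodgeFermatVarieties_of_hodgeAbelianVarieties_of_leaf_facts hSK hdim hJ hA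

/-- **Registered sub-goal `fermatAnchorAssembly_of_abelianAnchorAssembly_of_leaf_facts` — zero-seed fallback, form 2**
(the card's corollary reading): the crux from the sibling glue node `AbelianAnchorAssembly` (stmt-HodgeConjecture-14913) and
`HodgeLocusPropagation` (stmt-HodgeConjecture-14977), modulo the three leaf print facts; the engine hypotheses h1a
(`FormalLiftingFromClassLifting`) and h3a (`FormalVectorBundlesAlgebraize`) are consumed by the abelian node, h1b
(`PadicPridhamSemiregularity`, proved in the tree) is idle. [cite: ShiodaKatsura1979, §1 Thm. 1.7]
[cite: Milne1986JacobianVarieties, Thm. 1.1 and §2 Prop. 2.1] -/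
theorem fermatAnchorAssembly_of_abelianAnchorAssembly_of_leaf_facts : Literature.AlgebraicGeometry.HodgeTheory.FermatHodgeClassesLiftToCurvePowersSum → two_mul_dim_eq_finrank_bettiCohomology → nonempty_jacobian_of_algPoints.{0} → HodgeLocusPropagation → AbelianAnchorAssembly → FermatAnchorAssembly :=
  fun hSK hdim hJ hP hAAA _ h1a h3a =>
    hodgeFermatVarieties_of_hodgeAbelianVarieties_of_leaf_facts hSK hdim hJ (hAAA hP h1a h3a)

end Summit.HodgeConjecture.HodgeConjecture.Cruxes.FermatAnchorAssembly.ParallelizableAvatar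

end
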